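import Summits.BirchSwinnertonDyer.Rank1Residual.AdditivePotMult.HeegnerIndexRecordsThreeRankOne
import HarnessLib

/-!
# O5 = (t′) at `p = 3` (additive, TAME, potentially SUPERSINGULAR), rank ONE: the in-kernel recheck
# predicate for two-engine Heegner-index certificate rows (cell `b2b-bsdres`, team O5/O6, seat o5-r2, gen 3)

HONEST FRAMING (run/shared/lean/b2b/bsd-rank1-residual/, verbatim): the goal of the cell is to
DELETE the COMBINATION-SHAPED residual classes for ALL analytic-rank `≤ 1` elliptic curves over `ℚ`
— "full BSD formula for every rank `≤ 1` curve in class C" assembled STRICTLY from published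
theorems — so that the rank-`≤ 1` remainder becomes exactly the CONSTRUCTION-SHAPED classes, which
are TYPED (missing-input `Prop`s), NOT attempted. This is not "finishing BSD". Team O5/O6 works
RESEARCH ROUTES on the census cell O5 = (t′) (`p = 3`, `f₃ = 2`, `j̄ = 0`: additive, tame,
potentially supersingular; Kodaira III / I₀* / III*); no claim beyond the stated rows; census output
is EVIDENCE; nothing about elliptic curves is asserted here and NOTHING is booked by this file.
X4 labels are UNCHANGED.

SCHEMA ONLY (no data). The DATA records of the O5 rank-one exact-index campaign
(HOME/b2b-bsdres-o5-r2/gen3/HEEGIDX-O5-RANK1-P3.md) are `Row`s in the schema of additive-p1's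
`AdditivePotMult/HeegnerIndexRecordsThreeRankOne.lean` (p239723) — imported, not re-declared. That
file's recheck `Row.consistent` hard-codes the potentially-MULTIPLICATIVE class bit `ord₃ j < 0` (and
the pot.-multiplicative image device `3 ∤ ord₃ j`), so it cannot certify a (t′) row; this file supplies
the (t′) variant `rowConsistentT` — identical clause for clause except: CLASS BIT `9 ∥ N` (tame,
`f₃ = 2`), `c₄ ≠ 0`, `ord₃ j = 3·ord₃ c₄ − ord₃ Δ > 0` (`j̄ = 0`: potentially good, and — `j ≠ 0`, not CM —
potentially supersingular at `3`), `ord₃ Δ ∈ {3, 6, 9}` (Kodaira III / I₀* / III* on the reduced = minimal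
model); IMAGE clause = the galrep bit `surj` alone — and `CheckedT` with its `Decidable` instance, so the
parts `HeegnerIndexRecordsThreeRankOneT<k>.lean` are `decide +kernel` theorems.

READING of a `CheckedT` row (per pair; nothing booked here): with `r_an(E) = 1` (Cremona; the lane's
rank certification) and `ρ̄_{E,3}` onto (galrep), a row is an instance of additive-p1's CLASS-AGNOSTIC
`AdditivePotMult.bsdp_of_rankOne_of_indexCertificate_of_dvd` (p238704; "pair alone, ANY odd `p ∣ N_E`,
additive included, any Heegner field with `d_K < −4`": Kolyvagin via McCallum 1991 §1 / Gross 1991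
Thm. 1.3 — no hypothesis at `p` —, Gross–Zagier, GZK, modularity): `ord₃ #Ш(E)_an = 0` and `BSD(E,3)`;
and, for odd `D`, of `bsdp_and_bsdp_twist_of_indexCertificate_of_odd` ("class-agnostic (X4 any
additive type …)"): `BSD(E^{(D)},3)` for the rank-zero twist of conductor `N·D²`. The O5 conjecture
items `O5.O5HeegnerIndexThree` (T-O5-B), `O5.JetchevBoundFor` (S-O5-1), `O5.HeegnerIndexUpperAt`
(S-O5-2) are NOT used by such rows — they matter only for the Tamagawa-OBSTRUCTED (t′) rows.
NOT rechecked in the kernel (engine work): `L'(E,1)`, `L(F,1)`, periods, heights, the `3`-saturation /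
`E(K)[3] = 0` witnesses, `#Ш_an(F)`; `r_an(E) = 1`; surjectivity mod `3`.

References: HEEGIDX-O5-RANK1-P3.md (HOME/b2b-bsdres-o5-r2/gen3/); additive-p1 HEEGIDX-RANK1-BW.md;
McCallum 1991 §1 [McCallumLMS1991]; Gross 1991 Thm. 1.3 [GrossLMS1991]; Cremona's tables [Cremona2006].
-/

set_option autoImplicit false

namespace Summit.BirchSwinnertonDyer.Rank1Residual.O5.HeegnerIndexRecordsRankOne

open Summit.BirchSwinnertonDyer.BirchSwinnertonDyer.Rank1Residual.HeegnerIndexRecords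
  (vp v3 bInv discr c4 factorsOK psi3NoRootMod notCM weierstrassEvalZ)
open Summit.BirchSwinnertonDyer.Rank1Residual.AdditivePotMult.HeegnerIndexRecords (isFundDiscNeg)
open Summit.BirchSwinnertonDyer.Rank1Residual.AdditivePotMult.HeegnerIndexRecordsRankOne (Row)

/-- The in-kernel recheck of an O5 = (t′) rank-one row: additive-p1's `Row.consistent` (p239723) with the
potentially-multiplicative clause replaced by the (t′) clause — `9 ∥ N` (tame, `f₃ = 2`), `c₄ ≠ 0`,
`ord₃ j = 3·ord₃ c₄ − ord₃ Δ > 0` (`j̄ = 0`, potentially good), `ord₃ Δ ∈ {3, 6, 9}` (Kodaira III / I₀* /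
III* on the minimal model) — and the image clause reduced to the galrep bit `surj`. [folklore] -/
def rowConsistentT (r : Row) : Bool :=
  (r.ainvs.length == 5) && factorsOK r.N r.Nfactors && (r.N % 9 == 0) && (r.N % 27 != 0) &&
  (discr r.ainvs != 0) && (c4 r.ainvs != 0) && decide (0 < r.ordThreeJ) &&
  (vp 3 (discr r.ainvs) == 3 || vp 3 (discr r.ainvs) == 6 || vp 3 (discr r.ainvs) == 9) &&
  psi3NoRootMod r.ainvs r.irrWitness && notCM r.ainvs &&
  decide (r.D < -4) && (r.D % 3 != 0) && (Int.gcd r.D r.N == 1) && isFundDiscNeg r.D r.Dfactors &&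
  ((((r.hw : ℤ) ^ 2 - r.D) % (4 * (r.N : ℤ))) == 0) &&
  decide (1 ≤ r.Gd) && (weierstrassEvalZ r.ainvs r.GX r.GY r.Gd == 0) &&
  (r.tors % 3 != 0) && (r.tam % 3 != 0) && decide (1 ≤ r.optcode) && (r.manin == 1) &&
  (r.image == "surj") &&
  (r.NF == r.N * r.D.natAbs * r.D.natAbs) && (r.Ftors % 3 != 0) && decide (1 ≤ r.FshaAn) &&
  ((r.FshaAn * r.Ftam) % 3 != 0) &&
  (r.m1 == r.m2) && (r.v1 == 0) && (r.v2 == 0) && (r.m1 % 3 != 0)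

/-- A list of rows is `CheckedT` when every row passes `rowConsistentT`. [folklore] -/
def CheckedT (rs : List Row) : Prop := rs.all rowConsistentT = true

/-- `CheckedT rs` is decidable. [folklore] -/
instance CheckedT.instDecidable (rs : List Row) : Decidable (CheckedT rs) :=
  inferInstanceAs (Decidable (rs.all rowConsistentT = true))

/-- Unpacking `CheckedT`. [folklore] -/
theorem CheckedT.consistentT_of_mem {rs : List Row} (h : CheckedT rs) {r : Row} (hr : r ∈ rs) :
    rowConsistentT r = true :=
  List.all_eq_true.1 h r hr

/-- A `CheckedT` row has a `3`-adic UNIT two-engine index: `m₁ = m₂` and `3 ∤ m₁`. [folklore] -/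
theorem m_unit_of_rowConsistentT {r : Row} (h : rowConsistentT r = true) :
    r.m1 = r.m2 ∧ ¬ 3 ∣ r.m1 := by
  simp only [rowConsistentT, Bool.and_eq_true, bne_iff_ne, ne_eq, beq_iff_eq, decide_eq_true_eq] at h
  obtain ⟨⟨⟨⟨h1, hm12⟩, _⟩, _⟩, hm3⟩ := h
  exact ⟨hm12, fun hd => hm3 (Nat.mod_eq_zero_of_dvd hd)⟩

end Summit.BirchSwinnertonDyer.Rank1Residual.O5.HeegnerIndexRecordsRankOne
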